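import Summits.AtomisticToContinuum.Crystallization.Theorems.ExcessDecayLiouvillePhononStabilityCertChargeAccD

/-!
# Near-certificate layer XII-g: accumulated tables with general (rounded-up) weights (lead c2, vertex scheme)

Support file for crux `PhononStability` (stmt-AtomisticToContinuum-9333), line `contragredient-window-collapse`.

The exact chain weights `accW` (layer XII-e) have unbounded denominators (square-root length bounds), which makes
the accumulated table and everything downstream bignum-expensive.  Here the accumulation is generalised to an
arbitrary weight family `A c s` (`chainAccG`, with the evaluation identity `accVal_chainAccG`), and the charge
domination is proved for every family DOMINATING `accW` (`chargeSum_le_accValG`) — in particular for the weights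
rounded up to a fixed denominator (`accWR`, `chargeSum_le_accValR`).
-/

noncomputable section

open scoped BigOperators
open Set Function
open Summit.AtomisticToContinuum.Crystallization.Theorems.PhononStabilityNegative
open Summit.AtomisticToContinuum.Crystallization.Theorems.PhononStabilityCWC.FarControlStub

namespace Summit.AtomisticToContinuum.Crystallization.Theorems.PhononStabilityCWC.Cert

local notation "E3" => EuclideanSpace ℝ (Fin 3)

/-- the accumulated table of the range with a general weight family `A c s` -/
def chainAccG (A : BondClass → BondClass → ℚ) (ch : BondClass → List BondClass) (sl : List BondClass) (qn qf : ℤ) :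
    List AccE :=
  (classRange qn qf).foldl (fun tab c => (ch c).foldl (fun tab s => bumpW (A c s) c s sl tab) tab) (zeroTabW sl)

/-- folding the far classes with general weights. [folklore] -/
theorem accVal_foldl_classesG {w : Label → E3} (hw : (support w).Finite) (d : Fin 3 → ℝ) {sl : List BondClass}
    (hsl : sl.Nodup) (A : BondClass → BondClass → ℚ) (ch : BondClass → List BondClass) :
    ∀ (cs : List BondClass) (tab : List AccE), tab.length = sl.length → (∀ c ∈ cs, ∀ s ∈ ch c, s ∈ sl) →
      accVal d w sl (cs.foldl (fun tab c => (ch c).foldl (fun tab s => bumpW (A c s) c s sl tab) tab) tab) =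
        accVal d w sl tab + (cs.map fun c => ((ch c).map fun s =>
          (A c s : ℝ) * pairEvalR s (fun i j => zhat c d i * zhat c d j) w).sum).sum ∧
      (cs.foldl (fun tab c => (ch c).foldl (fun tab s => bumpW (A c s) c s sl tab) tab) tab).length = sl.length := by
  intro cs
  induction cs with
  | nil => intro tab hlen _; simp [hlen]
  | cons c rest ih =>
      intro tab hlen hmem
      rw [List.foldl_cons]
      obtain ⟨h1, h2⟩ := accVal_foldl_chainW hw d hsl (fun s => A c s) c (ch c) tab hlen
        (hmem c (List.mem_cons_self ..))
      obtain ⟨h3, h4⟩ := ih _ h2 (fun c' hc' => hmem c' (List.mem_cons_of_mem _ hc'))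
      refine ⟨?_, h4⟩
      rw [h3, h1, List.map_cons, List.sum_cons]
      ring

/-- **the general table evaluates to the weighted chain sums.** [folklore] -/
theorem accVal_chainAccG {w : Label → E3} (hw : (support w).Finite) (d : Fin 3 → ℝ) {sl : List BondClass}
    (hsl : sl.Nodup) (A : BondClass → BondClass → ℚ) (ch : BondClass → List BondClass) (qn qf : ℤ)
    (hsteps : ∀ c ∈ classRange qn qf, ∀ s ∈ ch c, s ∈ sl) :
    accVal d w sl (chainAccG A ch sl qn qf) = ((classRange qn qf).map fun c => ((ch c).map fun s =>
      (A c s : ℝ) * pairEvalR s (fun i j => zhat c d i * zhat c d j) w).sum).sum := by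
  unfold chainAccG
  obtain ⟨h1, -⟩ := accVal_foldl_classesG hw d hsl A ch (classRange qn qf) (zeroTabW sl) (by simp [zeroTabW]) hsteps
  rw [h1, accVal_zeroTabW, zero_add]

/-- the exact table is the general table of `accW`. [folklore] -/
theorem chainAccD_eq_chainAccG (D : ℕ) (ch : BondClass → List BondClass) (sl : List BondClass) (qn qf : ℤ) :
    chainAccD D ch sl qn qf = chainAccG (accW D ch) ch sl qn qf := rfl

/-- the rank-one pair form of a class direction is nonnegative. [folklore] -/
theorem pairEvalR_zhat_nonneg (δ : E3) (c s : BondClass) (w : Label → E3) :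
    0 ≤ pairEvalR s (fun i j => zhat c (contraOf δ) i * zhat c (contraOf δ) j) w := by
  rw [← dirForm_eq_pairEvalR_zhat]
  exact dirForm_nonneg _ _ _

/-- **DOMINATING WEIGHTS DOMINATE THE CHAIN CHARGES.** [folklore] -/
theorem chargeSum_le_accValG {D : ℕ} (hD : 0 < D) {Rn Rf : ℝ} {bn bf : ℕ} {qn qf : ℤ} (hbn : ⌈2 * Rn⌉₊ + 1 = bn)
    (hqn : ((qn : ℤ) : ℝ) = 36 * Rn ^ 2) (hbf : ⌈2 * Rf⌉₊ + 1 = bf) (hqf : ((qf : ℤ) : ℝ) = 36 * Rf ^ 2)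
    (hRn : 2 ≤ Rn) (hRf : 0 ≤ Rf) (ch : BondClass → List BondClass) {sl : List BondClass} (hsl : sl.Nodup)
    (hok : stepsOK ch sl qn qf = true) {A : BondClass → BondClass → ℚ}
    (hA : ∀ c ∈ classRange qn qf, ∀ s ∈ ch c, accW D ch c s ≤ A c s)
    {B : E3 →L[ℝ] E3} {δ : E3} (hW : CellWindow B) (hδ : ShiftWindow B δ)
    {w : Label → E3} (hw : (support w).Finite) :
    chargeSum Rn Rf ch B δ w ≤ accVal (contraOf δ) w sl (chainAccG A ch sl qn qf) := by
  have h1 := chargeSum_le_accVal hD hbn hqn hbf hqf hRn hRf ch hsl hok hW hδ hw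
  have hsteps : ∀ c ∈ classRange qn qf, ∀ s ∈ ch c, s ∈ sl := by
    unfold stepsOK at hok
    rw [List.all_eq_true] at hok
    intro c hc s hs
    have h2 := hok c hc
    rw [List.all_eq_true] at h2
    have h3 := h2 s hs
    simp only [Bool.and_eq_true, decide_eq_true_eq] at h3
    exact h3.1
  rw [accVal_chainAccD hw (contraOf δ) hsl D ch qn qf hsteps] at h1
  rw [accVal_chainAccG hw (contraOf δ) hsl A ch qn qf hsteps]
  refine h1.trans (List.sum_le_sum fun c hc => List.sum_le_sum fun s hs => ?_)
  exact mul_le_mul_of_nonneg_right (by exact_mod_cast hA c hc s hs) (pairEvalR_zhat_nonneg δ c s w)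

/-! ## Rounded-up weights -/

/-- round up to denominator `Da` -/
def roundUpQ (Da : ℕ) (x : ℚ) : ℚ := (⌈x * Da⌉ : ℚ) / Da

/-- rounding up dominates. [folklore] -/
theorem le_roundUpQ {Da : ℕ} (hDa : 0 < Da) (x : ℚ) : x ≤ roundUpQ Da x := by
  unfold roundUpQ
  rw [le_div_iff₀ (by exact_mod_cast hDa)]
  exact Int.le_ceil _

/-- the per-class factor `U_D(Q_c) · chainUp(ch c)` -/
def classW (D : ℕ) (ch : BondClass → List BondClass) (c : BondClass) : ℚ := uOfQD D (Qint c) * chainUp (ch c)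

/-- the rounded weight from the per-class factor (what the fast table computes per step) -/
def stepWR (Da : ℕ) (u : ℚ) (s : BondClass) : ℚ := roundUpQ Da (u * (lloQ (Qint s))⁻¹)

/-- **the rounded weights** `⌈accW · Da⌉ / Da` -/
def accWR (D Da : ℕ) (ch : BondClass → List BondClass) (c s : BondClass) : ℚ := stepWR Da (classW D ch c) s

/-- the rounded weights dominate the exact ones. [folklore] -/
theorem accW_le_accWR (D : ℕ) {Da : ℕ} (hDa : 0 < Da) (ch : BondClass → List BondClass) (c s : BondClass) :
    accW D ch c s ≤ accWR D Da ch c s := by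
  unfold accWR stepWR classW accW
  exact le_roundUpQ hDa _

/-- **THE ROUNDED TABLE DOMINATES THE CHAIN CHARGES.** [folklore] -/
theorem chargeSum_le_accValR {D Da : ℕ} (hD : 0 < D) (hDa : 0 < Da) {Rn Rf : ℝ} {bn bf : ℕ} {qn qf : ℤ}
    (hbn : ⌈2 * Rn⌉₊ + 1 = bn) (hqn : ((qn : ℤ) : ℝ) = 36 * Rn ^ 2) (hbf : ⌈2 * Rf⌉₊ + 1 = bf)
    (hqf : ((qf : ℤ) : ℝ) = 36 * Rf ^ 2) (hRn : 2 ≤ Rn) (hRf : 0 ≤ Rf) (ch : BondClass → List BondClass)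
    {sl : List BondClass} (hsl : sl.Nodup) (hok : stepsOK ch sl qn qf = true)
    {B : E3 →L[ℝ] E3} {δ : E3} (hW : CellWindow B) (hδ : ShiftWindow B δ) {w : Label → E3} (hw : (support w).Finite) :
    chargeSum Rn Rf ch B δ w ≤ accVal (contraOf δ) w sl (chainAccG (accWR D Da ch) ch sl qn qf) :=
  chargeSum_le_accValG hD hbn hqn hbf hqf hRn hRf ch hsl hok (fun c _ s _ => accW_le_accWR D hDa ch c s) hW hδ hw

/-- Anchor of this support file (registered stub of the line skeleton, lead c2): the general table over no steps. -/
theorem stub_certChargeAccR : chainAccG (fun _ _ => 0) (fun _ => []) [] 0 0 = [] := by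
  rfl

end Summit.AtomisticToContinuum.Crystallization.Theorems.PhononStabilityCWC.Cert

end
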